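import Literature.AnabelianGeometry.Anabelioids.Basic
import Mathlib.CategoryTheory.Galois.Full
import HarnessLib

/-!
# Anabelioids: 2-cells between two arrows `X ⇉ Y` and equivariant isomorphisms of basepoints

Mochizuki, *The geometry of anabelioids*, Publ. RIMS **40** (2004), §1.1, Corollary 1.1.6, p. 14
[cite: MochizukiGeoAn2004, Cor. 1.1.6 p.14], in its two-arrow form (the proof of Cor. 1.1.6 /
Prop. 1.1.4 via [SGA1, V, §4]: a morphism of fibre functors compatible with the fundamental groups
comes from a unique morphism of functors): for morphisms `φ, ψ : X → Y` of connected anabelioids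
(exact functors `φ^*, ψ^* : Y ⥤ X`) and a basepoint `β` of `X` (fibre functor `F`), the 2-cells
`φ ≅ ψ` correspond bijectively to the isomorphisms of the basepoints `φ^* ⋙ F ≅ ψ^* ⋙ F` of `Y` that
are equivariant for the two actions of `π₁(X, β) = Aut F` (`iso_equiv_equivariantIso`).  The
one-arrow case `φ = ψ` is `automorphisms_of_arrow` (`BasicProofs2.lean`).  Used by the [SemiAnbd] §2
rigidity statements (Rmk 2.4.2, [IUTchI] Rmk 2.5.3 (iii)).

Proof-only: no definitions.
-/

namespace Literature.AnabelianGeometry.Anabelioids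

open CategoryTheory CategoryTheory.Limits CategoryTheory.PreGaloisCategory

universe v₁ v₂ u₁ u₂

section

variable {X : Type u₁} [Category.{v₁} X] {Y : Type u₂} [Category.{v₂} Y]

/-- Whiskering a 2-cell with the basepoint is equivariant (naturality of `σ ∈ Aut F`). [folklore] -/
private theorem equivariant_of_app_eq (P P' : Y ⥤ X) (F : X ⥤ FintypeCat.{v₁}) (α : P ≅ P')
    (w : P ⋙ F ≅ P' ⋙ F) (hw : ∀ B, w.hom.app B = F.map (α.hom.app B)) (σ : Aut F) :
    Functor.isoWhiskerLeft P σ ≪≫ w = w ≪≫ Functor.isoWhiskerLeft P' σ := by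
  apply Iso.ext
  apply NatTrans.ext
  funext B
  simp only [Iso.trans_hom, NatTrans.comp_app, Functor.isoWhiskerLeft_hom, Functor.whiskerLeft_app,
    hw]
  exact (σ.hom.naturality (α.hom.app B)).symm

/-- Injectivity of `α ↦ α ⋆ F` for a faithful `F` (two-arrow form). [folklore] -/
private theorem isoWhiskerRight_injective' (P P' : Y ⥤ X) (F : X ⥤ FintypeCat.{v₁}) [F.Faithful] :
    Function.Injective fun α : P ≅ P' => Functor.isoWhiskerRight α F := by
  intro α α' h
  apply Iso.ext
  apply NatTrans.ext
  funext B
  have hB := congrArg (fun e : P ⋙ F ≅ P' ⋙ F => e.hom.app B) h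
  simp only [Functor.isoWhiskerRight_hom, Functor.whiskerRight_app] at hB
  exact F.map_injective hB

/-- Surjectivity: an `Aut F`-equivariant isomorphism of basepoints `P ⋙ F ≅ P' ⋙ F` is `α ⋆ F` for a
(unique) 2-cell `α : P ≅ P'` — full faithfulness of Mathlib's `functorToAction F` (SGA1 V §4),
naturality by faithfulness. [folklore] -/
private theorem exists_isoWhiskerRight_eq' [GaloisCategory X] (P P' : Y ⥤ X)
    (F : X ⥤ FintypeCat.{v₁}) [FiberFunctor F] (τ : P ⋙ F ≅ P' ⋙ F)
    (hτ : ∀ σ : Aut F, Functor.isoWhiskerLeft P σ ≪≫ τ = τ ≪≫ Functor.isoWhiskerLeft P' σ) :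
    ∃ α : P ≅ P', Functor.isoWhiskerRight α F = τ := by
  have hcomm : ∀ (B : Y) (σ : Aut F),
      σ.hom.app (P.obj B) ≫ τ.hom.app B = τ.hom.app B ≫ σ.hom.app (P'.obj B) := by
    intro B σ
    have h := congrArg (fun e : P ⋙ F ≅ P' ⋙ F => e.hom.app B) (hτ σ)
    simp only [Iso.trans_hom, NatTrans.comp_app, Functor.isoWhiskerLeft_hom,
      Functor.whiskerLeft_app] at h
    exact h
  let hF : (functorToAction F).FullyFaithful := Functor.FullyFaithful.ofFullyFaithful _
  let e : ∀ B : Y, (functorToAction F).obj (P.obj B) ≅ (functorToAction F).obj (P'.obj B) :=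
    fun B => Action.mkIso (τ.app B) fun σ => by
      ext x
      exact ConcreteCategory.congr_hom (hcomm B σ) x
  let a : ∀ B : Y, P.obj B ≅ P'.obj B := fun B => hF.preimageIso (e B)
  have ha : ∀ B : Y, F.map (a B).hom = τ.hom.app B := fun B => by
    have h1 : (functorToAction F).map (a B).hom = (e B).hom := hF.map_preimage _
    exact congrArg Action.Hom.hom h1
  have hnat : ∀ {B B' : Y} (f : B ⟶ B'), P.map f ≫ (a B').hom = (a B).hom ≫ P'.map f := by
    intro B B' f
    apply F.map_injective
    rw [F.map_comp, F.map_comp, ha, ha]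
    exact τ.hom.naturality f
  refine ⟨NatIso.ofComponents a hnat, ?_⟩
  apply Iso.ext
  apply NatTrans.ext
  funext B
  rw [Functor.isoWhiskerRight_hom, Functor.whiskerRight_app]
  exact ha B

end

/-- **Two-arrow form of [GeoAn] Corollary 1.1.6**: for morphisms of connected anabelioids
`φ, ψ : X → Y` and a basepoint `β` of `X` (fibre functor `F`), the 2-cells `φ ≅ ψ` (in the category
`Y ⥤ₑ X` of exact functors) are in natural bijection — `α ↦ α ⋆ F` — with the isomorphisms of
basepoints `φ^* ⋙ F ≅ ψ^* ⋙ F` equivariant for the actions of `π₁(X, β) = Aut F` through `π₁(φ)`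
and `π₁(ψ)`. [cite: MochizukiGeoAn2004, Cor. 1.1.6 p.14] -/
theorem iso_equiv_equivariantIso (X : Type u₁) [Category.{v₁} X] (Y : Type u₂) [Category.{v₂} Y]
    [GaloisCategory X] [GaloisCategory Y] (φ ψ : Hom X Y) (F : X ⥤ FintypeCat.{v₁}) [FiberFunctor F] :
    Nonempty ((φ ≅ ψ) ≃
      {τ : φ.pullback ⋙ F ≅ ψ.pullback ⋙ F //
        ∀ σ : Aut F, Functor.isoWhiskerLeft φ.pullback σ ≪≫ τ =
          τ ≪≫ Functor.isoWhiskerLeft ψ.pullback σ}) := by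
  let e₁ : (φ ≅ ψ) ≃ (φ.pullback ≅ ψ.pullback) := ((exactFunctor Y X).fullyFaithfulι).isoEquiv
  let f : (φ.pullback ≅ ψ.pullback) →
      {τ : φ.pullback ⋙ F ≅ ψ.pullback ⋙ F //
        ∀ σ : Aut F, Functor.isoWhiskerLeft φ.pullback σ ≪≫ τ =
          τ ≪≫ Functor.isoWhiskerLeft ψ.pullback σ} :=
    fun α => ⟨Functor.isoWhiskerRight α F,
      equivariant_of_app_eq φ.pullback ψ.pullback F α _ (fun B => by
        rw [Functor.isoWhiskerRight_hom, Functor.whiskerRight_app])⟩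
  have hf : Function.Bijective f := by
    constructor
    · intro α α' h
      exact isoWhiskerRight_injective' φ.pullback ψ.pullback F (congrArg Subtype.val h)
    · rintro ⟨τ, hτ⟩
      obtain ⟨α, hα⟩ := exists_isoWhiskerRight_eq' φ.pullback ψ.pullback F τ hτ
      exact ⟨α, Subtype.ext hα⟩
  exact ⟨e₁.trans (Equiv.ofBijective f hf)⟩

/-- The bijection of `iso_equiv_equivariantIso` is `α ↦ α ⋆ F` on the underlying functor 2-cell:
componentwise `F(α_B)`; in particular 2-cells `φ ≅ ψ` exist iff equivariant isomorphisms of the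
basepoints exist. [cite: MochizukiGeoAn2004, Cor. 1.1.6 p.14] -/
theorem nonempty_iso_iff_exists_equivariantIso (X : Type u₁) [Category.{v₁} X] (Y : Type u₂)
    [Category.{v₂} Y] [GaloisCategory X] [GaloisCategory Y] (φ ψ : Hom X Y)
    (F : X ⥤ FintypeCat.{v₁}) [FiberFunctor F] :
    Nonempty (φ.pullback ≅ ψ.pullback) ↔
      ∃ τ : φ.pullback ⋙ F ≅ ψ.pullback ⋙ F,
        ∀ σ : Aut F, Functor.isoWhiskerLeft φ.pullback σ ≪≫ τ =
          τ ≪≫ Functor.isoWhiskerLeft ψ.pullback σ := by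
  constructor
  · rintro ⟨α⟩
    exact ⟨Functor.isoWhiskerRight α F, equivariant_of_app_eq φ.pullback ψ.pullback F α _
      (fun B => by rw [Functor.isoWhiskerRight_hom, Functor.whiskerRight_app])⟩
  · rintro ⟨τ, hτ⟩
    obtain ⟨α, -⟩ := exists_isoWhiskerRight_eq' φ.pullback ψ.pullback F τ hτ
    exact ⟨α⟩

end Literature.AnabelianGeometry.Anabelioids
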